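import Summits.ABC.IUTFork.Joshi.ATS1AnabelianHyperbolic
import Mathlib.Data.ZMod.Basic

/-!
# [J-I] §12 — a NON-VACUITY WITNESS for the signature `ATS1.HyperbolicVarietyDatum` and joint satisfiability of the typed §12 claims

Companion of `Joshi/ATS1AnabelianHyperbolic.lean` (p432225; abc-iut cell block E, rung LADDER-ABC:A2.E, seat abc-iut-E-t12, slot T-51;
E-plan-2 ruling 08:35Z «AUTHORS FIRST for NV witnesses of their own interface structures»). SOURCE of the typed statements: K. Joshi,
arXiv:2106.11452v4 §12 (bib `Joshi2021ATS1`). INTERFACE-LEVEL ONLY: the model below is NOT a model of varieties / fundamental groups;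
it certifies (i) that the signature `HyperbolicVarietyDatum` is inhabited and (ii) that the typed §12 package — `HyperbolicCurveIff`
(§12.2), `Prop1251` (Prop. 12.5.1), `Prop1254` (Prop. 12.5.4), `ExistsNonAnabelianHyperbolic` (Rmk. 12.5.3), `Rmk1262Dim1` (Rmk. 12.6.2 (2)),
together with the conjecture shell `Conj1261` (Conj. 12.6.1) — is JOINTLY SATISFIABLE in kernel, i.e. the typing carries no hidden
contradiction (consistency ≠ truth; typed ≠ proved ≠ endorsed). No side taken on [IUTchIII] Cor. 3.12 or on any author.

THE MODEL `boolDatum`: two "varieties" `false` (a "curve": `dim = 1`, `π₁ = ℤ/1` trivial, SLIM) and `true` (`dim = 2`, `π₁ = ℤ/2` with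
the discrete topology, NOT slim — a commutative nontrivial group centralises its open subgroup `⊤`); both "hyperbolic"; the geometric
tempered groups trivial; every basis of opens is `{false}`; `Isom` sets are singletons; `IsoZ` is `True`. Then `false` is anabelian
hyperbolic and `true` is hyperbolic but not anabelian hyperbolic (Rmk. 12.5.3's shape), and all universally quantified claims hold.
-/

noncomputable section

namespace Summit.ABC.IUTFork.Joshi.ATS1

open Literature.AlgebraicGeometry.Frobenioids (IsSlimGroup)

/-! ## 1. Two small topological groups: `ℤ/1` (slim) and `ℤ/2` discrete (not slim) -/

/-- The group attached to the object `b`: `ℤ/(if b then 2 else 1)`, written multiplicatively. [folklore] -/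
abbrev grpOf (b : Bool) : Type := Multiplicative (ZMod (cond b 2 1))

/-- Discrete topology on the model groups. [folklore] -/
instance instTopGrpOf (b : Bool) : TopologicalSpace (grpOf b) := ⊥

/-- … which is discrete. [folklore] -/
instance instDiscreteGrpOf (b : Bool) : DiscreteTopology (grpOf b) := ⟨rfl⟩

/-- … hence a topological group. [folklore] -/
instance instIsTopologicalGroupGrpOf (b : Bool) : IsTopologicalGroup (grpOf b) where
  continuous_mul := continuous_of_discreteTopology
  continuous_inv := continuous_of_discreteTopology

/-- A subsingleton topological group is slim (every centraliser is `⊥ = ⊤`). [folklore] -/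
theorem isSlimGroup_of_subsingleton (G : Type) [Group G] [TopologicalSpace G] [Subsingleton G] : IsSlimGroup G :=
  ⟨fun H _ => by
    rw [eq_bot_iff]
    intro x _
    rw [Subgroup.mem_bot]
    exact Subsingleton.elim x 1⟩

/-- `ℤ/1` is slim. [folklore] -/
theorem isSlimGroup_grpOf_false : IsSlimGroup (grpOf false) := by
  haveI : Subsingleton (grpOf false) := by
    show Subsingleton (ZMod 1)
    exact ZMod.subsingleton_iff.2 rfl
  exact isSlimGroup_of_subsingleton _

/-- A nontrivial COMMUTATIVE topological group is not slim: the open subgroup `⊤` has centraliser `⊤ ≠ ⊥`. [folklore] -/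
theorem not_isSlimGroup_of_comm (G : Type) [CommGroup G] [TopologicalSpace G] [Nontrivial G] : ¬ IsSlimGroup G := by
  intro h
  have htop := h.centralizer_eq_bot ⊤ isOpen_univ
  have hall : Subgroup.centralizer ((⊤ : Subgroup G) : Set G) = ⊤ := by
    rw [eq_top_iff]
    intro g _
    rw [Subgroup.mem_centralizer_iff]
    intro x _
    exact mul_comm x g
  rw [hall] at htop
  exact top_ne_bot htop

/-- `ℤ/2` (discrete) is NOT slim. [folklore] -/
theorem not_isSlimGroup_grpOf_true : ¬ IsSlimGroup (grpOf true) := by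
  haveI : Nontrivial (grpOf true) := by
    show Nontrivial (ZMod 2)
    infer_instance
  exact not_isSlimGroup_of_comm _

/-! ## 2. The two-object datum -/

/-- **`boolDatum` — an inhabited `HyperbolicVarietyDatum`** (interface-level witness; see the module docstring for the dictionary).
[folklore] -/
def boolDatum : HyperbolicVarietyDatum.{0} where
  Var := Bool
  dim := fun b => cond b 2 1
  IsOpenOf := fun _ _ => True
  IsBasisOf := fun _ 𝒰 => 𝒰 = {false}
  isOpenOf_of_mem := fun _ _ _ _ _ => trivial
  IsHyperbolic := fun _ => True
  IsHyperbolicRiemannSurface := fun _ => True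
  pi1 := grpOf
  pi1GeomTemp := fun _ => grpOf false
  IsomE := fun _ _ => Unit
  IsomOut := fun _ _ => Unit
  isomMap := fun _ _ => id
  IsoZ := fun _ _ => True

/-- The signature is inhabited. [folklore] -/
theorem nonempty_hyperbolicVarietyDatum : Nonempty HyperbolicVarietyDatum.{0} := ⟨boolDatum⟩

/-- In the model, `false` (the "curve") is anabelian hyperbolic. [folklore] -/
theorem boolDatum_isAnabelianHyperbolic_false : boolDatum.IsAnabelianHyperbolic false :=
  ⟨trivial, isSlimGroup_grpOf_false, isSlimGroup_grpOf_false⟩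

/-- In the model, `true` is hyperbolic but NOT anabelian hyperbolic (its `π₁ = ℤ/2` is not slim). [folklore] -/
theorem boolDatum_not_isAnabelianHyperbolic_true : ¬ boolDatum.IsAnabelianHyperbolic true :=
  fun h => not_isSlimGroup_grpOf_true h.2.1

/-- An anabelian hyperbolic object of the model is `false`. [folklore] -/
theorem boolDatum_eq_false_of_isAnabelianHyperbolic {X : Bool} (h : boolDatum.IsAnabelianHyperbolic X) : X = false := by
  cases X
  · rfl
  · exact absurd h boolDatum_not_isAnabelianHyperbolic_true

/-! ## 3. Every typed §12 claim holds in the model (joint satisfiability) -/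

/-- §12.2 holds in the model. [folklore] -/
theorem boolDatum_hyperbolicCurveIff : boolDatum.HyperbolicCurveIff := fun _ _ => Iff.rfl

/-- Prop. 12.5.1 holds in the model (basis `{false}`; `Isom` maps are `id`; `π₁(false)` slim). [folklore] -/
theorem boolDatum_prop1251 : boolDatum.Prop1251 := by
  intro X _
  refine ⟨{false}, rfl, fun _ _ => trivial, fun U hU V hV => ?_, fun U hU => ?_⟩
  · exact Function.bijective_id
  · have hU' : U = false := hU
    subst hU'
    exact isSlimGroup_grpOf_false

/-- Prop. 12.5.4 holds in the model (the only object of dimension `1` is `false`). [folklore] -/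
theorem boolDatum_prop1254 : boolDatum.Prop1254 := by
  intro X hX _
  cases X
  · exact boolDatum_isAnabelianHyperbolic_false
  · exact absurd hX (by decide)

/-- Rmk. 12.5.3 holds in the model (`true` is hyperbolic, not anabelian hyperbolic). [folklore] -/
theorem boolDatum_existsNonAnabelianHyperbolic : boolDatum.ExistsNonAnabelianHyperbolic :=
  ⟨true, trivial, boolDatum_not_isAnabelianHyperbolic_true⟩

/-- The conjecture shell Conj. 12.6.1 is TRUE in the model (`IsoZ` is `True`) — consistency of the shell with the rest, nothing more.
[folklore] -/
theorem boolDatum_conj1261 : boolDatum.Conj1261 := fun _ _ _ _ _ => trivial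

/-- Rmk. 12.6.2 (2) holds in the model. [folklore] -/
theorem boolDatum_rmk1262Dim1 : boolDatum.Rmk1262Dim1 := boolDatum.rmk1262Dim1_of_conj1261 boolDatum_conj1261

/-- **Joint satisfiability of the typed §12 package** (interface level): one datum in which the signature is inhabited and
`HyperbolicCurveIff ∧ Prop1251 ∧ Prop1254 ∧ ExistsNonAnabelianHyperbolic ∧ Conj1261 ∧ Rmk1262Dim1` all hold — the typing of
[J-I] §12 carries no hidden contradiction. Consistency ≠ truth; typed ≠ proved. [folklore] -/
theorem boolDatum_profile :
    boolDatum.HyperbolicCurveIff ∧ boolDatum.Prop1251 ∧ boolDatum.Prop1254 ∧ boolDatum.ExistsNonAnabelianHyperbolic ∧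
      boolDatum.Conj1261 ∧ boolDatum.Rmk1262Dim1 :=
  ⟨boolDatum_hyperbolicCurveIff, boolDatum_prop1251, boolDatum_prop1254, boolDatum_existsNonAnabelianHyperbolic,
    boolDatum_conj1261, boolDatum_rmk1262Dim1⟩

/-- Anabelomorphy is non-trivial in the model: `false` and `true` are NOT anabelomorphic (`ℤ/1 ≄ ℤ/2`), so `Conj1261` is not
satisfied vacuously-by-antecedent only; and `false` is anabelomorphic to itself. [folklore] -/
theorem boolDatum_anabelomorphic_profile :
    boolDatum.Anabelomorphic false false ∧ ¬ boolDatum.Anabelomorphic false true := by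
  refine ⟨boolDatum.anabelomorphic_refl false, fun h => ?_⟩
  exact not_isSlimGroup_grpOf_true (boolDatum.isSlimGroup_pi1_of_anabelomorphic h isSlimGroup_grpOf_false)

/-- The labeling function of §13.6 on E-t1's `ATSObj.variation` is available (type-checks) — a usage witness for `labeling` over the
[J-I] carrier of record. [folklore] -/
example {p : ℕ} [Fact p.Prime] (X : Literature.AnabelianGeometry.SemiGraphs.TemperedCurve p) (A : ATSObj X) :
    (labeling (ATSObj.variation X) A).label = A.α := rfl

end Summit.ABC.IUTFork.Joshi.ATS1

end
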